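import Literature.Analysis.Fourier.HyperbolicSymbolLinearEigenvalues
import Literature.Analysis.Matrix.StrictPencilSpectralData
import Literature.Barriers.AtomisticToContinuum.NoBVEstimatesMultiDLinearStepReduction
import Literature.Barriers.AtomisticToContinuum.NoBVEstimatesMultiDLinearStepSymmetric
import HarnessLib

/-!
# Rauch's linear step: proof of `Rauch1986_LpMultiplier_forces_commutation` (Brenner's
Corollary 3.1 for Rauch's multiplier)

`NoBVEstimatesMultiDLinearStep.lean` vendors as the named fact
`Rauch1986_LpMultiplier_forces_commutation` the theorem behind the last sentence of
[Rauch1986, Proof of Theorem p. 483] — "we now appeal to the result of Brenner [1, 2] which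
states that (3) is a necessary and sufficient condition for `M` to be an `Lᵖ` multiplier for some
`1 < p < ∞`, `p ≠ 2`" — as printed by Brenner [Brenner1973, Cor 3.1 p. 84] for the homogeneous
pencil of Rauch's multiplier without zeroth-order term: for a constant-coefficient system in
Rauch's class at `0` and `T > 0`, if `M_T = rauchSymbol A₀ A 0 T ∈ M_p`, `1 < p < ∞`, `p ≠ 2`,
then the `A₀⁻¹Aⱼ` commute. This file PROVES it (`Rauch1986_LpMultiplier_forces_commutation_holds`).

Proof. By dilation the phase symbols `exp(-inK(ξ))`, `K_l = 2πTA₀⁻¹A_l`, form a uniform `M_p`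
family (`uniformPhaseFamily_of_isLpMultiplier_rauchSymbol`, `NoBVEstimatesMultiDLinearStepReduction.lean`).
* Symmetrizable branch: `K_l = R⁻¹K'_lR` with symmetric `K'_l` (`exists_conj_isSymm_rauchPencil`),
  the family conjugates to one for `K'` (`UniformPhaseFamily.conj`), and Brenner–Thomée–Wahlbin's
  Lemma 1.1 in uniform-family form (`hasLinearEigenvalues_of_uniform_exp_family`,
  `HyperbolicSymbolLinearEigenvalues.lean`) gives linear eigenvalues of the hermitean pencil
  `-K'`, whence the `K'_l` commute by Lemma 1.2 (`HasLinearEigenvalues.commute`), and so do the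
  `K_l` and the `A₀⁻¹A_l` [BrennerThomeeWahlbin1975, Ch. 5 §1 Thm 1.1, Lemmas 1.1–1.2].
* Strictly hyperbolic branch [Brenner1973, Thm 3.1, Cor 3.1 p. 84]: for `d ≤ 1` or `k ≤ 1` the
  conclusion is trivial [Rauch1986, Examples 1–2]; for `d, k ≥ 2` the same rescaling argument
  (`fderiv_fderiv_apply_eq_zero_of_uniformPhaseBound`, `PhaseSymbolRescaling.lean`) run on the
  smooth simple branches and eigenprojections of the strictly hyperbolic pencil near a point
  `ξ⁰ ≠ 0` (`exists_strictSpectralData`, `StrictPencilSpectralData.lean`) makes the branches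
  affine, hence the eigenvalues linear (`hasLinearEigenvalues_of_affine_on_ball`), which is
  impossible for a strictly hyperbolic pencil with `d, k ≥ 2`
  (`IsStrictlyHyperbolicPencil.not_hasLinearEigenvalues`): the hypothesis `M_T ∈ M_p` is
  contradictory in this case ("linear hyperbolic systems in dimension greater than one are not
  well posed in `Lᵖ` for `p ≠ 2`" [Rauch1986, p. 481]).

## References

* [Rauch1986] J. Rauch, Comm. Math. Phys. 106 (1986) 481–484, p. 481, Examples 1–2 p. 482,
  Proof of Theorem p. 483 (last sentence).
* [Brenner1973] P. Brenner, Ark. Mat. 11 (1973) 75–101, Thm 3.1 and Cor 3.1 p. 84.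
* [BrennerThomeeWahlbin1975] P. Brenner, V. Thomée, L. B. Wahlbin, LNM 434 (1975), Ch. 1
  Thm 2.8; Ch. 5 §1 Thm 1.1, Lemmas 1.1–1.2.
-/

noncomputable section

open MeasureTheory Complex Real Filter Topology Set Metric Polynomial
open scoped ENNReal NNReal ContDiff Matrix

namespace Literature.Barriers.AtomisticToContinuum

open Literature.Analysis.Fourier Literature.Analysis.Matrix Literature.Analysis.ODE
  Literature.LinearAlgebra.Matrix QuasilinearSystem

variable {d k : ℕ}

/-! ### The phase symbols as exponentials of the complexified pencil -/

/-- `exp(Σ (-inξ_l)K_l) = exp(in · pencil(-K)(ξ))`: Rauch's phase symbol without zeroth-order term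
is the exponential of `((n·1) i)` times the pencil of the matrices `-K_l ⊗ ℂ`.
[cite: Rauch1986, Proof of Theorem p. 483] -/
theorem rauchPhaseSymbol_zero_eq_exp_pencil (K : Fin d → Matrix (Fin k) (Fin k) ℝ) (n : ℝ)
    (ξ : Space d) :
    rauchPhaseSymbol K 0 n ξ =
      NormedSpace.exp ((((n * 1 : ℝ) : ℂ) * I) • pencil (fun j => (-K j).map (algebraMap ℝ ℂ)) ξ) := by
  unfold rauchPhaseSymbol pencil
  congr 1
  rw [Matrix.map_zero _ (map_zero _), add_zero, Finset.smul_sum]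
  refine Finset.sum_congr rfl fun l _ => ?_
  dsimp only
  rw [Matrix.map_neg _ (map_neg (algebraMap ℝ ℂ)), smul_neg, smul_neg, smul_smul, ← neg_smul]
  congr 1
  push_cast
  ring

/-- No zeroth-order term: `rauchZeroth A₀ 0 T = 0`. [folklore] -/
theorem rauchZeroth_zero (A₀ : Matrix (Fin k) (Fin k) ℝ) (T : ℝ) : rauchZeroth A₀ 0 T = 0 := by
  unfold rauchZeroth
  rw [ContinuousLinearMap.toLinearMap_zero, LinearEquiv.map_zero, Matrix.mul_zero, smul_zero, neg_zero]

/-- A uniform phase family, re-indexed: the symbols at `n + 1`, `n = 0, 1, …`, as exponentials of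
the complexified pencil `-K`. [folklore] -/
theorem uniformFamily_exp_pencil {p : ℝ≥0∞} {K : Fin d → Matrix (Fin k) (Fin k) ℝ}
    (h : UniformPhaseFamily p K 0) :
    ∃ C : ℝ≥0, ∀ n : ℕ, IsLpMultiplierWith p C (fun ξ : EuclideanSpace ℝ (Fin d) =>
      NormedSpace.exp ((((((n : ℝ) + 1) * 1 : ℝ) : ℂ) * I) •
        pencil (fun j => (-K j).map (algebraMap ℝ ℂ)) ξ)) := by
  obtain ⟨C, hC⟩ := h
  refine ⟨C, fun n => ?_⟩
  have h1 := hC ((n : ℝ) + 1) (by positivity)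
  have heq : rauchPhaseSymbol K 0 ((n : ℝ) + 1) = fun ξ : EuclideanSpace ℝ (Fin d) =>
      NormedSpace.exp ((((((n : ℝ) + 1) * 1 : ℝ) : ℂ) * I) •
        pencil (fun j => (-K j).map (algebraMap ℝ ℂ)) ξ) :=
    funext fun ξ => rauchPhaseSymbol_zero_eq_exp_pencil K _ ξ
  rwa [heq] at h1

/-! ### The symmetrizable branch -/

/-- Conjugation preserves commutation. [folklore] -/
theorem commute_conj {M N R : Matrix (Fin k) (Fin k) ℝ} (hR : IsUnit R.det) (h : Commute M N) :
    Commute (R⁻¹ * M * R) (R⁻¹ * N * R) := by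
  have hRR' : R * R⁻¹ = 1 := Matrix.mul_nonsing_inv _ hR
  change R⁻¹ * M * R * (R⁻¹ * N * R) = R⁻¹ * N * R * (R⁻¹ * M * R)
  calc R⁻¹ * M * R * (R⁻¹ * N * R) = R⁻¹ * (M * (R * R⁻¹) * N) * R := by
        simp only [Matrix.mul_assoc]
    _ = R⁻¹ * (N * (R * R⁻¹) * M) * R := by rw [hRR', Matrix.mul_one, Matrix.mul_one, h.eq]
    _ = R⁻¹ * N * R * (R⁻¹ * M * R) := by simp only [Matrix.mul_assoc]

/-- **Symmetric pencils with a uniform phase family commute** (Lemma 1.1 in uniform-family form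
and Lemma 1.2): if the `K_l` are real symmetric, `1 ≤ p ≤ ∞`, `p ≠ 2`, and the phase symbols
`exp(-inK(ξ))`, `n ≠ 0`, are in `M_p` with one constant, then the `K_l` commute.
[cite: BrennerThomeeWahlbin1975, Ch. 5 §1 Thm 1.1, Lemmas 1.1–1.2] -/
theorem commute_of_uniformPhaseFamily_symmetric {p : ℝ≥0∞} (hp1 : 1 ≤ p) (hp2 : p ≠ 2)
    {K : Fin d → Matrix (Fin k) (Fin k) ℝ} (hK : ∀ j, (K j).IsSymm)
    (h : UniformPhaseFamily p K 0) (j l : Fin d) : Commute (K j) (K l) := by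
  set A : Fin d → Matrix (Fin k) (Fin k) ℂ := fun j => (-K j).map (algebraMap ℝ ℂ) with hA
  have hAh : ∀ j, (A j).IsHermitian := fun j => isHermitian_map_of_isSymm (hK j).neg
  obtain ⟨C, hC⟩ := uniformFamily_exp_pencil h
  have hlin : HasLinearEigenvalues A :=
    hasLinearEigenvalues_of_uniform_exp_family hAh hp1 hp2 (s := 1) one_ne_zero hC
  have hcomm : Commute (A j) (A l) := hlin.commute hAh j l
  have hreal : Commute (-K j) (-K l) := commute_of_commute_map hcomm
  exact (Commute.neg_left_iff.1 (Commute.neg_right_iff.1 hreal))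

/-! ### The strictly hyperbolic branch -/

/-- **A strictly hyperbolic pencil with `d, k ≥ 2` admits no uniform phase family in `M_p`,
`p ≠ 2`** [Brenner1973, Thm 3.1, Cor 3.1]: the rescaling argument on the smooth simple branches
near `ξ⁰ ≠ 0` would make the eigenvalues linear, contradicting strict hyperbolicity.
[cite: Brenner1973, Thm 3.1 and Cor 3.1 p. 84; Rauch1986, p. 481] -/
theorem not_uniformPhaseFamily_of_strictlyHyperbolic {p : ℝ≥0∞} (hp1 : 1 ≤ p) (hp2 : p ≠ 2)
    {K : Fin d → Matrix (Fin k) (Fin k) ℝ} (hK : IsStrictlyHyperbolicPencil K) (hd : 2 ≤ d)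
    (hk : 2 ≤ k) (h : UniformPhaseFamily p K 0) : False := by
  classical
  -- the pencil `-K` is strictly hyperbolic and carries the family `exp(i(n+1) pencil(-K))`
  set K' : Fin d → Matrix (Fin k) (Fin k) ℝ := fun j => -K j with hK'
  have hK'h : IsStrictlyHyperbolicPencil K' := by
    have h1 := IsStrictlyHyperbolicPencil.smul (K := K) hK (c := -1) (by norm_num)
    have heq : (fun j => (-1 : ℝ) • K j) = K' := funext fun j => by rw [hK', neg_one_smul]
    rwa [heq] at h1
  set A : Fin d → Matrix (Fin k) (Fin k) ℂ := fun j => (K' j).map (algebraMap ℝ ℂ) with hA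
  obtain ⟨C, hC⟩ := uniformFamily_exp_pencil h
  -- a base point `ξ⁰ ≠ 0` and the smooth spectral data there
  set ξ₀ : EuclideanSpace ℝ (Fin d) := EuclideanSpace.single ⟨0, by omega⟩ (1 : ℝ) with hξ₀
  have hξ₀0 : ξ₀ ≠ 0 := by
    intro h0
    have := congr_arg (fun v : EuclideanSpace ℝ (Fin d) => v ⟨0, by omega⟩) h0
    simp [hξ₀] at this
  obtain ⟨ρ, hρ, μ, hsmooth, hinj, hchar, hproj⟩ := exists_strictSpectralData hK'h hξ₀0
  -- every branch is affine on the ball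
  have haff : ∀ a : Fin k, ∃ (L : EuclideanSpace ℝ (Fin d) →L[ℝ] ℝ) (c : ℝ),
      ∀ ξ ∈ ball ξ₀ ρ, μ a ξ = L ξ + c := by
    intro a
    have hNP : ∀ n : ℕ, ∀ ξ ∈ ball ξ₀ ρ,
        NormedSpace.exp ((((((n : ℝ) + 1) * 1 : ℝ) : ℂ) * I) • pencil A ξ) *
            lagrangeProj (pencil A ξ) (fun b => ((μ b ξ : ℝ) : ℂ)) a =
          cexp (I * ((((n : ℝ) + 1) * μ a ξ : ℝ) : ℂ)) •
            lagrangeProj (pencil A ξ) (fun b => ((μ b ξ : ℝ) : ℂ)) a := by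
      intro n ξ hξ
      set τ : ℂ := (((((n : ℝ) + 1) * 1 : ℝ) : ℂ) * I) with hτ
      have hdec := eq_sum_smul_lagrangeProj (hinj ξ hξ) (hchar ξ hξ)
      have hexp : τ • pencil A ξ =
          ∑ b, (τ * ((μ b ξ : ℝ) : ℂ)) • lagrangeProj (pencil A ξ) (fun b => ((μ b ξ : ℝ) : ℂ)) b := by
        conv_lhs => rw [hdec]
        rw [Finset.smul_sum]
        exact Finset.sum_congr rfl fun b _ => by rw [smul_smul]
      rw [hexp]
      have key := exp_sum_smul_mul_idempotent
        (completeOrthogonalIdempotents_lagrangeProj (hinj ξ hξ) (hchar ξ hξ))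
        (fun b => τ * ((μ b ξ : ℝ) : ℂ)) a
      refine key.trans ?_
      congr 2
      rw [hτ]
      push_cast
      ring
    have h0 : ∀ ξ₁ ∈ ball ξ₀ ρ, ∀ v, fderiv ℝ (fderiv ℝ (μ a)) ξ₁ v v = 0 := fun ξ₁ hξ₁ v =>
      fderiv_fderiv_apply_eq_zero_of_uniformPhaseBound hp1 hp2 hC (hsmooth a) (hproj a)
        (fun ξ hξ => lagrangeProj_ne_zero (hinj ξ hξ) (hchar ξ hξ) a) hNP hξ₁ v
    exact exists_affine_of_fderiv_fderiv_apply_eq_zero hρ (hsmooth a) h0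
  choose L c hLc using haff
  -- hence linear eigenvalues, contradicting strict hyperbolicity
  have hlin : HasLinearEigenvalues A := by
    refine hasLinearEigenvalues_of_affine_on_ball A L c (fun _ => 1) (ξ₀ := ξ₀) hρ fun ξ hξ => ?_
    rw [hchar ξ hξ]
    exact Finset.prod_congr rfl fun a _ => by rw [pow_one, hLc a ξ hξ]
  exact hK'h.not_hasLinearEigenvalues hd hk hlin

/-! ### Trivial cases -/

/-- `k ≤ 1`: square matrices of size `≤ 1` commute. [cite: Rauch1986, Example 2 p. 482] -/
theorem commute_of_le_one (hk : k ≤ 1) (M N : Matrix (Fin k) (Fin k) ℝ) : Commute M N := by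
  haveI : Subsingleton (Fin k) := Fin.subsingleton_iff_le_one.2 hk
  refine (commute_iff_eq M N).2 (Matrix.ext fun i j => ?_)
  have hij : j = i := Subsingleton.elim j i
  subst hij
  rw [Matrix.mul_apply, Matrix.mul_apply, Fintype.sum_subsingleton _ j, Fintype.sum_subsingleton _ j,
    mul_comm]

/-! ### The theorem -/

/-- **Proof of `Rauch1986_LpMultiplier_forces_commutation`** (Brenner's Corollary 3.1 for
Rauch's multiplier without zeroth-order term, both branches of Rauch's class; see the module
docstring). [cite: Rauch1986, Proof of Theorem p. 483 (last sentence); Brenner1973, Cor 3.1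
p. 84; BrennerThomeeWahlbin1975, Ch. 5 §1 Thm 1.1, Lemmas 1.1–1.2] -/
theorem Rauch1986_LpMultiplier_forces_commutation_holds :
    Rauch1986_LpMultiplier_forces_commutation := by
  intro d k A₀ A hS T p hT hp1 hptop hp2 hM j l
  have hp1' : 1 ≤ p := hp1.le
  -- the uniform phase family of the dilates
  have hfam : UniformPhaseFamily p (rauchPencil A₀ A T) 0 := by
    have h := uniformPhaseFamily_of_isLpMultiplier_rauchSymbol hM
    rwa [rauchZeroth_zero] at h
  obtain ⟨U, hU, hcases⟩ := hS.hyperbolic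
  have h0U : (0 : Fin k → ℝ) ∈ U := mem_of_mem_nhds hU
  rcases hcases with ⟨Sym, -, hSym⟩ | hst
  · -- symmetrizable branch
    obtain ⟨hpos, hsymm⟩ := hSym 0 h0U
    simp only [ofConstant_A0, ofConstant_A] at hpos hsymm
    obtain ⟨R, hR, K', hK', hconj⟩ := exists_conj_isSymm_rauchPencil A₀ A (Sym 0) hpos hsymm T
    -- the family for `K'`: conjugate by `R⁻¹`
    have hR' : IsUnit (R⁻¹).det := Matrix.isUnit_nonsing_inv_det R hR
    have hfam' : UniformPhaseFamily p K' 0 := by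
      have h1 := hfam.conj (R⁻¹) hR'
      have hK'eq : (fun l => (R⁻¹)⁻¹ * rauchPencil A₀ A T l * R⁻¹) = K' := by
        funext l
        rw [hconj l, Matrix.nonsing_inv_nonsing_inv R hR]
        have hRR' : R * R⁻¹ = 1 := Matrix.mul_nonsing_inv _ hR
        calc R * (R⁻¹ * K' l * R) * R⁻¹ = (R * R⁻¹) * K' l * (R * R⁻¹) := by
              simp only [Matrix.mul_assoc]
          _ = K' l := by rw [hRR', Matrix.one_mul, Matrix.mul_one]
      have hE : (R⁻¹)⁻¹ * (0 : Matrix (Fin k) (Fin k) ℝ) * R⁻¹ = 0 := by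
        rw [Matrix.mul_zero, Matrix.zero_mul]
      rwa [hK'eq, hE] at h1
    have hcomm : Commute (K' j) (K' l) :=
      commute_of_uniformPhaseFamily_symmetric hp1' hp2 hK' hfam' j l
    have hpen : Commute (rauchPencil A₀ A T j) (rauchPencil A₀ A T l) := by
      rw [hconj j, hconj l]
      exact commute_conj hR hcomm
    exact commute_of_commute_rauchPencil hT.ne' hpen
  · -- strictly hyperbolic branch
    obtain ⟨-, hstrict⟩ := hst 0 h0U
    rcases Nat.lt_or_ge d 2 with hd | hd
    · -- `d ≤ 1`: only one matrix
      have : Subsingleton (Fin d) := Fin.subsingleton_iff_le_one.2 (by omega)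
      rw [Subsingleton.elim j l]
    rcases Nat.lt_or_ge k 2 with hk | hk
    · exact commute_of_le_one (by omega) _ _
    · exact (not_uniformPhaseFamily_of_strictlyHyperbolic hp1' hp2
        (isStrictlyHyperbolicPencil_rauchPencil hstrict hT.ne') hd hk hfam).elim

end Literature.Barriers.AtomisticToContinuum

end
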